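import Literature.MathematicalPhysics.QuantumFieldTheory.Balaban1983to89.B3Op116DKernelRegularTorus
import Literature.MathematicalPhysics.QuantumFieldTheory.Balaban1983to89.B3Ineq211RegularTorus

/-!
# Bałaban, *(Higgs)₂,₃ quantum fields in a finite volume III. Renormalization* [B3] — THE HÖLDER QUOTIENT OF THE ROW DERIVATIVE
OF THE KERNEL OF (1.16) p. 414 ON THE TORUS, for all `(n, n′)` with `n ≥ 1` and `n + n′ + 1 − α > d` — FILE 4γ of the cell's
programme for the analytic half of (1.16): the last factor `G_k(T,B̃)V_k` read through its (2.11) Hölder member instead of its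
(2.10) differentiated column, on top of FILE 4β₂'s majorant state of `(1.16)_{n−1,n′}`

statement-level skeleton of published theorems with citation tags; proofs where landed; nothing here is a claim about the Yang–Mills mass gap

T. Bałaban, Commun. Math. Phys. **88** (1983) 411–445 [cite: Balaban1983Higgs3]; part I, Commun. Math. Phys. **85** (1982) 603–636
[cite: Balaban1982Higgs1].  PDFs held: `paper:balaban1983-higgs-2-3-quantum-fields-finite-volume` (journal page = PDF page + 410;
p. 414 = `p0004.txt`, p. 426 = `p0016.txt`), `paper:balaban1982-cmp85-higgs23-i` (p. 610–611 = `p0008.txt`–`p0009.txt`).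

CITATION HEADER (lean-in-tree rule).  Cell `lit-balaban` (HOME `run/shared/lean/pub/lit-balaban/`), proof seat **p35** gen 22
(unit `lit-balaban-p35`); TAKING line HOME/STATUS 2026-08-23T05:03:06Z (4α/4β/4γ = p35, 4M = p40 g73); design
`lit-balaban-p35/DESIGN-FILE4.md` §5(c), §7, §9(c).  SKELETON rows **B3.Eq1.16 (analytic half)** / **B3.Eq2.5** (fold owner r15) —
LOCATED MEMBER, no head claim; decl of record `B3Sect2StatementsPart2.ScaledKernels.Ineq25At` (r15), binder `hH` of p40's
`B3Ineq25Op116Smooth.ineq25At_op116_smooth_torus_of_bounds`.  Programme files: FILE 4α `B3Op116LeibnizRows` (p35), FILE 4β₁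
`B3Op116MajorantStep` (p35), FILE 4β₂ `B3Op116DKernelRegularTorus` (p35: `state_op116_cb`, the state of `(1.16)_{n,n′}e`), the torus
(2.11) member `B3Op116BoxRows.hcol_le_univ` (p35 gen 21, from `B3Ineq211RegularRegion.ineq211At_regularRegion_small_explicit`) which
DISCHARGES this file's hypothesis `h211` on the torus, p26's `B3Ineq211RegularTorus.IsAdm`, r14 g13's `B1TorusChainTransport.hol`.
USED BY NAME, never restated: `B3Op116LeibnizRows.norm_mapE_srcV_le_leibniz`, `B3Op116MajorantStep.{maj, row_step_le, stepC, …}`,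
`B3Op116DKernelRegularTorus.{state_op116_cb, rateAt, cvAt, cdAt, seqC_pos, kap4}`, r14's `B3Op116KernelRegularTorus.norm_mapE_avgSrc_le_block`,
`B3Op116SourceForm.{covDerivAt, op116_succ_left_apply}`, p33's `B3Op116MajorantConvolution.majorant_le_top`.

## What is printed

[B3] p. 414 [PDF 4] (verbatim): *"More exactly the Hölder norms of the covariant derivatives of this kernel, the norms defined for
example in the inequalities (I.2.24) and (I.2.25) of Proposition I.2.1, are exponentially decaying with the distance of the arguments and
are uniformly bounded by O(1)(e(L^kε)^{1−α})^{n+n′}, where α > 0 but can be arbitrarily small."*  [B3] p. 426 (2.11) [PDF 16]: the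
Hölder member of the pieces, *"|(U(B̃(Γ_{b,b′}))(D^η_{B̃}G^η_{(j)})(Ω,B̃;b′,x) − (D^η_{B̃}G^η_{(j)})(Ω,B̃;b,x)| ≤
O(1)(L^jη)^{−d+1−α}e^{−δ₁(L^jη)^{−1}dist({b,b′},x)}|b−b′|^α"* (typed for the cell as `Ineq211At`).

## What this file proves, and how

§1 THE HÖLDER FUNCTIONAL `T_{x₁,x₂,Γ,μ}φ = U(B(Γ_{x₁,x₂}))(D^ε_Bφ)(⟨x₂,μ⟩) − (D^ε_Bφ)(⟨x₁,μ⟩)` (`holT`, linear) and the HÖLDER COLUMN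
`κ^H(y) = Σ_i‖T(G_k(T,B)e_{(y,i)})‖` (`hcol`); the row of `G_k(T,B)V_k(A,B)w` through `T` is FILE 4α's L-form row with the kernel `κ^H`
(`norm_holT_G_srcV_le`).  §2 A row is monotone and additive in its kernel (`row_le_of_kernel_le_add`): `κ^H ≤ (ε|x₁−x₂|)^α(𝔪₁ + 𝔪₂)`
(the two one-anchor majorants of the (2.11) member, anchors `x₁` and `x₂`, exponent `1 − α`) splits the row into two rows to which
FILE 4β₁'s `row_step_le` applies (`a_K = 1 − α > 0`).  §3 **`kernel116_holder_le`**: for `(1.16)_{n+1,n′} = G_k(T,B)V_k(1.16)_{n,n′}`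
with `(1.16)_{n,n′}e_{(x′,i′)}` in FILE 4β₂'s state `n + n′`, the Hölder quotient of the row derivative is
`≤ (ε|x₁−x₂|)^α·holC·(L^kε)^{M}·(L^kε)((L^kε)^d)^{−1}((L^kε)^α)^{−1}·e^{−δ_M·min(|x₁−x′|,|x₂−x′|)/L^k}`, `M = n+1+n′`, whenever
`d < 1 + M − α` — p40's binder `hH` (the two top-scale bumps `e^{−δ|x_i−x′|/L^k}` are each below the `min` profile).

## Honest scope

Torus only; outer factor `G_k(T,B̃)` (`n ≥ 1`; for `n = 0` the outer propagator is `G_k(T,Ã+B̃)` and the transport/derivative of p40's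
binder are those of `B̃` — a split `U(B̃(Γ)) = U((Ã+B̃)(Γ))U(−Ã(Γ))` would be needed, not done: print's *"n, n′ sufficiently large"*).
The (2.11) input enters as the HYPOTHESIS `h211` in the exact shape of `B3Op116BoxRows.hcol_le_univ`'s conclusion (discharged there on
the torus for `(I.2.23)`-regular `B̃` with `L^kδ_B|e| ≤ t`), the (2.10) inputs as r15's `Ineq210 δ₁ C` for `B` and `A + B` (as in FILE
4β₂), `A` regular with `δ_A`, `α < 1` (the binder shape is meaningful for `0 ≤ α`).  Constants explicit (`holC`), not simplified.  Concrete `def`s (`holT`, `hcol`, `holC`); no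
`def … : Prop`, no new named fact; axioms standard.  Value = located engine of a by-reference step of B3, NOT summit progress.
-/

noncomputable section

open scoped BigOperators

namespace Literature.MathematicalPhysics.QuantumFieldTheory.Balaban1983to89.B3Op116HolderKernelRegularTorus

open HiggsLattice (ChargeData ScalarField covDeriv)
open HiggsCovariance (propagatorK E)
open HiggsAveraging (blockK blockIter)
open B1Eq230FluctCov (Ix cb)
open B1TorusChainTransport (hol)
open B3Ineq211RegularTorus (IsAdm)
open B3Ineq210RegularRegion (regRegionKernels)
open B3Op116SourceForm (srcV avgSrc covDerivAt op116_succ_left_apply)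
open B3Op116KernelRegularTorus (norm_mapE_avgSrc_le_block)
open B3Op116LeibnizRows (norm_mapE_srcV_le_leibniz)
open B3Op116MajorantStep (maj maj_nonneg maj_rate_mono stepC stepC_nonneg row_step_le)
open B3Op116DKernelRegularTorus (state_op116_cb rateAt cvAt cdAt seqC_pos kap4 kap4_nonneg cK1 cK1_ge)
open B3Op116MajorantConvolution (majorant_le_top)
open B3Eq116TwoSidedExpansion (op116)

variable {P : HiggsLattice.Params} {N : ℕ}

/-! ## §1 The Hölder functional and the Hölder column of `G_k(T,B)` -/

section Functional

variable (C : ChargeData N) (B : HiggsLattice.VecField P 0)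

/-- **The Hölder functional** `T_{x₁,x₂,Γ,μ}φ = U(B(Γ_{x₁,x₂}))(D^ε_Bφ)(⟨x₂,μ⟩) − (D^ε_Bφ)(⟨x₁,μ⟩)` — the transported difference of the
covariant derivative at the two collinear bonds at `x₂` and `x₁` (the numerator of the (2.11)/(I.2.24) Hölder quotient), linear in `φ`.
[cite: Balaban1983Higgs3, (2.11) p.426] [cite: Balaban1982Higgs1, (2.24) p.610] -/
def holT (x₁ x₂ : HiggsLattice.Site P 0) (Γ : List (HiggsLattice.Site P 0)) (μ : Fin P.d) : ScalarField P 0 N →ₗ[ℝ] E N :=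
  (hol C B x₁ Γ : E N →L[ℝ] E N).toLinearMap ∘ₗ covDerivAt C B ⟨x₂, μ⟩ - covDerivAt C B ⟨x₁, μ⟩

/-- `T_{x₁,x₂,Γ,μ}φ = U(B(Γ))(D^ε_Bφ)(⟨x₂,μ⟩) − (D^ε_Bφ)(⟨x₁,μ⟩)`. [cite: Balaban1983Higgs3, (2.11) p.426] -/
@[simp] theorem holT_apply (x₁ x₂ : HiggsLattice.Site P 0) (Γ : List (HiggsLattice.Site P 0)) (μ : Fin P.d) (φ : ScalarField P 0 N) :
    holT C B x₁ x₂ Γ μ φ = hol C B x₁ Γ (covDeriv C B φ ⟨x₂, μ⟩) - covDeriv C B φ ⟨x₁, μ⟩ := rfl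

variable (msq a : ℝ) (k : ℕ)

/-- **The Hölder column of `G_k(T_ε,B)`**: `κ^H_{x₁,x₂,Γ,μ}(y) = Σ_i‖U(B(Γ))(D^ε_BG_k(T,B)e_{(y,i)})(⟨x₂,μ⟩) − (D^ε_BG_k(T,B)e_{(y,i)})(⟨x₁,μ⟩)‖`
(the numerator of (2.11), summed over the internal index). [cite: Balaban1983Higgs3, (2.11) p.426] -/
def hcol (x₁ x₂ : HiggsLattice.Site P 0) (Γ : List (HiggsLattice.Site P 0)) (μ : Fin P.d) (y : HiggsLattice.Site P 0) : ℝ :=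
  ∑ i : Ix N, ‖holT C B x₁ x₂ Γ μ (propagatorK C Finset.univ B msq a k (cb P N 0 (y, i)))‖

/-- `κ^H ≥ 0`. [cite: Balaban1983Higgs3, (2.11) p.426] -/
theorem hcol_nonneg (x₁ x₂ : HiggsLattice.Site P 0) (Γ : List (HiggsLattice.Site P 0)) (μ : Fin P.d) (y : HiggsLattice.Site P 0) :
    0 ≤ hcol C B msq a k x₁ x₂ Γ μ y :=
  Finset.sum_nonneg fun _ _ => norm_nonneg _

variable {C B msq a k}
variable (A : HiggsLattice.VecField P 0)

/-- **The Hölder row of `G_k(T,B)V_k(A,B)w`** (torus; `sup_b|A_b| ≤ s`, `A` regular with `δ_A`): FILE 4α's L-form row through `T ∘ G_k(T,B)`,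
kernel `κ^H`. [cite: Balaban1983Higgs3, (1.16) p.414, (2.11) p.426] [cite: Balaban1982Higgs1, (3.16) p.615] -/
theorem norm_holT_G_srcV_le {s δA : ℝ} (hA : ∀ b : HiggsLattice.PBond P 0, |A b| ≤ s)
    (hregA : ∀ (z : HiggsLattice.Site P 0) (μ ν : Fin P.d), |A ⟨z.shift ν, μ⟩ - A ⟨z, μ⟩| ≤ δA)
    (x₁ x₂ : HiggsLattice.Site P 0) (Γ : List (HiggsLattice.Site P 0)) (μ : Fin P.d) (w : ScalarField P 0 N) :
    ‖holT C B x₁ x₂ Γ μ (propagatorK C Finset.univ B msq a k (srcV C A B k Finset.univ a w))‖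
      ≤ (∑ b : HiggsLattice.PBond P 0,
          (|C.e| * s * ‖covDeriv C B w b‖ * hcol C B msq a k x₁ x₂ Γ μ b.tgt
            + ((P.mesh 0)⁻¹ * (|C.e| * δA) * ‖w b.src‖ + |C.e| * s * ‖covDeriv C B w b‖) * hcol C B msq a k x₁ x₂ Γ μ b.src
            + (|C.e| * s) ^ 2 * ‖w b.tgt‖ * hcol C B msq a k x₁ x₂ Γ μ b.tgt))
        + |B1.aSeq a P.L k| * (P.mesh k)⁻¹ ^ 2 *
            ‖holT C B x₁ x₂ Γ μ (propagatorK C Finset.univ B msq a k (avgSrc C A B k w))‖ := by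
  have h := norm_mapE_srcV_le_leibniz C A B a k
    (holT C B x₁ x₂ Γ μ ∘ₗ (propagatorK C Finset.univ B msq a k : ScalarField P 0 N →ₗ[ℝ] ScalarField P 0 N)) hA hregA w
  simp only [LinearMap.coe_comp, Function.comp_apply] at h
  exact h

end Functional

/-! ## §2 A row is monotone and additive in its kernel -/

section RowMono

/-- **Monotonicity/additivity of a row in its kernel**: if `0 ≤ K ≤ c(M₁ + M₂)` pointwise and all charges are nonnegative, then the row
of FILE 4β₁ (`Σ_b[κ₁D(b)K(b₊) + (κ₂V(b₋) + κ₁D(b))K(b₋) + κ₃V(b₊)K(b₊)] + κ₄Σ_zK(z)·Blk_zV`) at `K` is at most `c` times the sum of the rows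
at `M₁` and `M₂`. [cite: Balaban1983Higgs3, (1.16) p.414] -/
theorem row_le_of_kernel_le_add {k : ℕ} {κ₁ κ₂ κ₃ κ₄ c : ℝ} (hκ₁ : 0 ≤ κ₁) (hκ₂ : 0 ≤ κ₂) (hκ₃ : 0 ≤ κ₃) (hκ₄ : 0 ≤ κ₄)
    (K M₁ M₂ : HiggsLattice.Site P 0 → ℝ) (hK : ∀ y, K y ≤ c * (M₁ y + M₂ y))
    (Vf : HiggsLattice.Site P 0 → ℝ) (hV0 : ∀ y, 0 ≤ Vf y) (Df : HiggsLattice.PBond P 0 → ℝ) (hD0 : ∀ b, 0 ≤ Df b) :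
    (∑ b : HiggsLattice.PBond P 0,
        (κ₁ * Df b * K b.tgt + (κ₂ * Vf b.src + κ₁ * Df b) * K b.src + κ₃ * Vf b.tgt * K b.tgt))
      + κ₄ * ∑ z : HiggsLattice.Site P 0, K z * (((P.L : ℝ) ^ (k * P.d))⁻¹ * ∑ u ∈ blockK k (blockIter k z), Vf u)
      ≤ c * (((∑ b : HiggsLattice.PBond P 0,
          (κ₁ * Df b * M₁ b.tgt + (κ₂ * Vf b.src + κ₁ * Df b) * M₁ b.src + κ₃ * Vf b.tgt * M₁ b.tgt))
        + κ₄ * ∑ z : HiggsLattice.Site P 0, M₁ z * (((P.L : ℝ) ^ (k * P.d))⁻¹ * ∑ u ∈ blockK k (blockIter k z), Vf u))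
        + ((∑ b : HiggsLattice.PBond P 0,
          (κ₁ * Df b * M₂ b.tgt + (κ₂ * Vf b.src + κ₁ * Df b) * M₂ b.src + κ₃ * Vf b.tgt * M₂ b.tgt))
        + κ₄ * ∑ z : HiggsLattice.Site P 0, M₂ z * (((P.L : ℝ) ^ (k * P.d))⁻¹ * ∑ u ∈ blockK k (blockIter k z), Vf u))) := by
  have hblk : ∀ z, 0 ≤ ((P.L : ℝ) ^ (k * P.d))⁻¹ * ∑ u ∈ blockK k (blockIter k z), Vf u :=
    fun z => mul_nonneg (inv_nonneg.mpr (pow_nonneg (Nat.cast_nonneg _) _)) (Finset.sum_nonneg fun u _ => hV0 u)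
  -- pointwise in b
  have hb : ∀ b : HiggsLattice.PBond P 0,
      κ₁ * Df b * K b.tgt + (κ₂ * Vf b.src + κ₁ * Df b) * K b.src + κ₃ * Vf b.tgt * K b.tgt
        ≤ c * ((κ₁ * Df b * M₁ b.tgt + (κ₂ * Vf b.src + κ₁ * Df b) * M₁ b.src + κ₃ * Vf b.tgt * M₁ b.tgt)
          + (κ₁ * Df b * M₂ b.tgt + (κ₂ * Vf b.src + κ₁ * Df b) * M₂ b.src + κ₃ * Vf b.tgt * M₂ b.tgt)) := by
    intro b
    have h1 : 0 ≤ κ₁ * Df b := mul_nonneg hκ₁ (hD0 b)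
    have h2 : 0 ≤ κ₂ * Vf b.src + κ₁ * Df b := add_nonneg (mul_nonneg hκ₂ (hV0 _)) h1
    have h3 : 0 ≤ κ₃ * Vf b.tgt := mul_nonneg hκ₃ (hV0 _)
    have e : c * ((κ₁ * Df b * M₁ b.tgt + (κ₂ * Vf b.src + κ₁ * Df b) * M₁ b.src + κ₃ * Vf b.tgt * M₁ b.tgt)
          + (κ₁ * Df b * M₂ b.tgt + (κ₂ * Vf b.src + κ₁ * Df b) * M₂ b.src + κ₃ * Vf b.tgt * M₂ b.tgt))
        = κ₁ * Df b * (c * (M₁ b.tgt + M₂ b.tgt)) + (κ₂ * Vf b.src + κ₁ * Df b) * (c * (M₁ b.src + M₂ b.src))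
          + κ₃ * Vf b.tgt * (c * (M₁ b.tgt + M₂ b.tgt)) := by ring
    rw [e]
    exact add_le_add (add_le_add (mul_le_mul_of_nonneg_left (hK _) h1) (mul_le_mul_of_nonneg_left (hK _) h2))
      (mul_le_mul_of_nonneg_left (hK _) h3)
  have hz : ∀ z : HiggsLattice.Site P 0,
      K z * (((P.L : ℝ) ^ (k * P.d))⁻¹ * ∑ u ∈ blockK k (blockIter k z), Vf u)
        ≤ c * ((M₁ z * (((P.L : ℝ) ^ (k * P.d))⁻¹ * ∑ u ∈ blockK k (blockIter k z), Vf u))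
          + (M₂ z * (((P.L : ℝ) ^ (k * P.d))⁻¹ * ∑ u ∈ blockK k (blockIter k z), Vf u))) := by
    intro z
    have e : c * ((M₁ z * (((P.L : ℝ) ^ (k * P.d))⁻¹ * ∑ u ∈ blockK k (blockIter k z), Vf u))
          + (M₂ z * (((P.L : ℝ) ^ (k * P.d))⁻¹ * ∑ u ∈ blockK k (blockIter k z), Vf u)))
        = (c * (M₁ z + M₂ z)) * (((P.L : ℝ) ^ (k * P.d))⁻¹ * ∑ u ∈ blockK k (blockIter k z), Vf u) := by ring
    rw [e]
    exact mul_le_mul_of_nonneg_right (hK z) (hblk z)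
  have S1 := Finset.sum_le_sum fun b (_ : b ∈ (Finset.univ : Finset (HiggsLattice.PBond P 0))) => hb b
  have S2 := Finset.sum_le_sum fun z (_ : z ∈ (Finset.univ : Finset (HiggsLattice.Site P 0))) => hz z
  have E1 : ∑ b : HiggsLattice.PBond P 0,
      c * ((κ₁ * Df b * M₁ b.tgt + (κ₂ * Vf b.src + κ₁ * Df b) * M₁ b.src + κ₃ * Vf b.tgt * M₁ b.tgt)
          + (κ₁ * Df b * M₂ b.tgt + (κ₂ * Vf b.src + κ₁ * Df b) * M₂ b.src + κ₃ * Vf b.tgt * M₂ b.tgt))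
      = c * ∑ b : HiggsLattice.PBond P 0,
          (κ₁ * Df b * M₁ b.tgt + (κ₂ * Vf b.src + κ₁ * Df b) * M₁ b.src + κ₃ * Vf b.tgt * M₁ b.tgt)
        + c * ∑ b : HiggsLattice.PBond P 0,
          (κ₁ * Df b * M₂ b.tgt + (κ₂ * Vf b.src + κ₁ * Df b) * M₂ b.src + κ₃ * Vf b.tgt * M₂ b.tgt) := by
    rw [Finset.mul_sum, Finset.mul_sum, ← Finset.sum_add_distrib]
    exact Finset.sum_congr rfl fun b _ => by ring
  have E2 : ∑ z : HiggsLattice.Site P 0,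
      c * ((M₁ z * (((P.L : ℝ) ^ (k * P.d))⁻¹ * ∑ u ∈ blockK k (blockIter k z), Vf u))
          + (M₂ z * (((P.L : ℝ) ^ (k * P.d))⁻¹ * ∑ u ∈ blockK k (blockIter k z), Vf u)))
      = c * ∑ z : HiggsLattice.Site P 0, M₁ z * (((P.L : ℝ) ^ (k * P.d))⁻¹ * ∑ u ∈ blockK k (blockIter k z), Vf u)
        + c * ∑ z : HiggsLattice.Site P 0, M₂ z * (((P.L : ℝ) ^ (k * P.d))⁻¹ * ∑ u ∈ blockK k (blockIter k z), Vf u) := by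
    rw [Finset.mul_sum, Finset.mul_sum, ← Finset.sum_add_distrib]
    exact Finset.sum_congr rfl fun z _ => by ring
  rw [E1] at S1
  rw [E2] at S2
  have S2' := mul_le_mul_of_nonneg_left S2 hκ₄
  refine (add_le_add S1 S2').trans (le_of_eq ?_)
  ring

end RowMono

/-! ## §3 The Hölder clause of the kernel of (1.16) on the torus -/

section Holder

/-- the constant of `kernel116_holder_le`: `2ε^{−d}·N·stepC(1−α, …, state J)/(L^{1+M−α−d} − 1)` with `J = M − 1` the state index of the
inner field. [cite: Balaban1983Higgs3, (1.16) p.414] -/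
def holC (P : HiggsLattice.Params) (N : ℕ) (C : ChargeData N) (k : ℕ) (a δ₁ Cst s δA α cH : ℝ) (J : ℕ) : ℝ :=
  2 * ((P.mesh 0 ^ P.d)⁻¹ * (Fintype.card (Ix N) : ℝ) *
    (stepC P N k (rateAt P N C k a Cst s δA δ₁ (P.mesh 0 ^ P.d * Cst) (cK1 P C k Cst s) J) (1 - α) (2 + (J : ℝ)) cH
        (cvAt P N C k a Cst s δA δ₁ (P.mesh 0 ^ P.d * Cst) (cK1 P C k Cst s) J) (cdAt P N C k a Cst s δA δ₁ (P.mesh 0 ^ P.d * Cst) (cK1 P C k Cst s) J)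
        (|C.e| * s) ((P.mesh 0)⁻¹ * (|C.e| * δA)) ((|C.e| * s) ^ 2) (kap4 P C k a s)
      / ((P.L : ℝ) ^ ((1 : ℝ) + ((J + 1 : ℕ) : ℝ) - α - (P.d : ℝ)) - 1)))

variable {C : ChargeData N} {A B : HiggsLattice.VecField P 0} {msq a : ℝ} {k K₀ : ℕ} {hL1 : 1 < P.L} {δ₁ Cst s δA α cH : ℝ}

/-- scale algebra: `(L^kε)^{1+M−α−d} = (L^kε)^M·((L^kε)((L^kε)^d)^{−1}((L^kε)^α)^{−1})`. [cite: Balaban1983Higgs3, (2.11) p.426] -/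
theorem mesh_rpow_split_holder (M : ℕ) (α : ℝ) :
    P.mesh k ^ ((1 : ℝ) + (M : ℝ) - α - (P.d : ℝ)) = P.mesh k ^ M * (P.mesh k * (P.mesh k ^ P.d)⁻¹ * (P.mesh k ^ α)⁻¹) := by
  have hm : 0 < P.mesh k := P.mesh_pos k
  rw [show (1 : ℝ) + (M : ℝ) - α - (P.d : ℝ) = (((1 + M : ℕ) : ℝ) - (P.d : ℝ)) - α by push_cast; ring,
    Real.rpow_sub hm, Real.rpow_sub hm, Real.rpow_natCast, Real.rpow_natCast, pow_add, pow_one, div_eq_mul_inv, div_eq_mul_inv]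
  ring

/-- two one-anchor bumps are below twice the two-anchor `min` profile. [cite: Balaban1983Higgs3, (2.11) p.426] -/
theorem exp_add_exp_le_two_exp_min {δ r : ℝ} (hδ : 0 ≤ δ) (hr : 0 < r) (t₁ t₂ : ℝ) :
    Real.exp (-(δ * (t₁ / r))) + Real.exp (-(δ * (t₂ / r))) ≤ 2 * Real.exp (-(δ * (min t₁ t₂ / r))) := by
  have h1 : Real.exp (-(δ * (t₁ / r))) ≤ Real.exp (-(δ * (min t₁ t₂ / r))) := by
    apply Real.exp_le_exp.mpr
    have : min t₁ t₂ / r ≤ t₁ / r := div_le_div_of_nonneg_right (min_le_left _ _) hr.le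
    nlinarith
  have h2 : Real.exp (-(δ * (t₂ / r))) ≤ Real.exp (-(δ * (min t₁ t₂ / r))) := by
    apply Real.exp_le_exp.mpr
    have : min t₁ t₂ / r ≤ t₂ / r := div_le_div_of_nonneg_right (min_le_right _ _) hr.le
    nlinarith
  linarith

variable (hδ₁ : 0 < δ₁) (hδ₁1 : δ₁ ≤ 1) (hCst : 0 ≤ Cst)
  (h210B : (regRegionKernels hL1 C Finset.univ B msq a k K₀).Ineq210 δ₁ Cst)
  (h210AB : (regRegionKernels hL1 C Finset.univ (A + B) msq a k K₀).Ineq210 δ₁ Cst)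
  (hmsq : 0 < msq) (ha : 0 < a) (hk : 1 ≤ k) (hkK : k ≤ P.K) (i₀ : Ix N)
  (hs : 0 ≤ s) (hA : ∀ b : HiggsLattice.PBond P 0, |A b| ≤ s) (hδA : 0 ≤ δA)
  (hregA : ∀ (z : HiggsLattice.Site P 0) (μ ν : Fin P.d), |A ⟨z.shift ν, μ⟩ - A ⟨z, μ⟩| ≤ δA)
  (hα1 : α < 1) (hcH : 0 ≤ cH)
  (h211 : ∀ (μ : Fin P.d) (x₁ x₂ y : HiggsLattice.Site P 0), x₁ ≠ x₂ → ∀ Γ : List (HiggsLattice.Site P 0), IsAdm x₁ x₂ Γ →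
    (∑ i : Ix N, ‖hol C B x₁ Γ (covDeriv C B (propagatorK C Finset.univ B msq a k (cb P N 0 (y, i))) ⟨x₂, μ⟩)
        - covDeriv C B (propagatorK C Finset.univ B msq a k (cb P N 0 (y, i))) ⟨x₁, μ⟩‖)
        / (P.mesh 0 * (HiggsLattice.Site.tdist x₁ x₂ : ℝ)) ^ α
      ≤ ∑ j ∈ Finset.range k, cH * P.mesh j ^ (((1 : ℝ) - α) - (P.d : ℝ)) *
          (Real.exp (-(δ₁ * (P.mesh j)⁻¹ * (P.mesh 0 * (HiggsLattice.Site.tdist x₁ y : ℝ)))) +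
            Real.exp (-(δ₁ * (P.mesh j)⁻¹ * (P.mesh 0 * (HiggsLattice.Site.tdist x₂ y : ℝ))))))
include hδ₁ hδ₁1 hCst h210B h210AB hmsq ha hk hkK i₀ hs hA hδA hregA hα1 hcH h211

/-- **THE HÖLDER QUOTIENT OF THE ROW DERIVATIVE OF THE KERNEL OF (1.16) ON THE TORUS, FOR ALL `n ≥ 1`, `d < n + n′ + 2 − α`**
(print's *"the Hölder norms of the covariant derivatives of this kernel … are exponentially decaying … uniformly bounded"*, p. 414): on
`Ω = T_ε`, under the hypotheses of `B3Op116DKernelRegularTorus.kernel116_deriv_le` and the (2.11) Hölder member `h211` of `G_k(T,B)`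
(exponent `1 − α`, `α < 1`; = `B3Op116BoxRows.hcol_le_univ` on the torus), for every `n, n′` with `d < 1 + (n+1+n′) − α`, every
direction `μ`, sites `x₁ ≠ x₂`, `x′`, and admissible contour `Γ` from `x₁` to `x₂`:
`ε^{−d}Σ_{i′}‖U(B(Γ))(D^ε_B(1.16)_{n+1,n′}e_{(x′,i′)})(⟨x₂,μ⟩) − (D^ε_B(1.16)_{n+1,n′}e_{(x′,i′)})(⟨x₁,μ⟩)‖
≤ (ε|x₁−x₂|)^α·holC·(L^kε)^{n+1+n′}·((L^kε)((L^kε)^d)^{−1}((L^kε)^α)^{−1})·exp(−δ_{n+1+n′}·min(|x₁−x′|,|x₂−x′|)/L^k)` — p40's binder `hH`.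
The last factor `G_k(T,B)V_k` is read through the Hölder column `κ^H ≤ (ε|x₁−x₂|)^α(𝔪(x₁,·) + 𝔪(x₂,·))` (two anchors, exponent `1−α`),
the inner field `(1.16)_{n,n′}e` through FILE 4β₂'s state `n + n′`; no `D G D^*` kernel, no logarithm of `k`.
[cite: Balaban1983Higgs3, (1.16) p.414, (2.5) p.424, (2.11) p.426] [cite: Balaban1982Higgs1, Prop. 2.1 (2.24) p.610, (3.16) p.615] -/
theorem kernel116_holder_le (n n' : ℕ) (hd : (P.d : ℝ) < 1 + ((n + 1 + n' : ℕ) : ℝ) - α) (μ : Fin P.d)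
    (x₁ x₂ x' : HiggsLattice.Site P 0) (hne : x₁ ≠ x₂) (Γ : List (HiggsLattice.Site P 0)) (hΓ : IsAdm x₁ x₂ Γ) :
    (P.mesh 0 ^ P.d)⁻¹ * ∑ i' : Ix N,
        ‖hol C B x₁ Γ (covDeriv C B (op116 C Finset.univ A B msq a k (n + 1) n' (cb P N 0 (x', i'))) ⟨x₂, μ⟩)
          - covDeriv C B (op116 C Finset.univ A B msq a k (n + 1) n' (cb P N 0 (x', i'))) ⟨x₁, μ⟩‖
      ≤ (P.mesh 0 * (HiggsLattice.Site.tdist x₁ x₂ : ℝ)) ^ α *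
          (holC P N C k a δ₁ Cst s δA α cH (n + n') * P.mesh k ^ (n + 1 + n') *
            (P.mesh k * (P.mesh k ^ P.d)⁻¹ * (P.mesh k ^ α)⁻¹)) *
          Real.exp (-(rateAt P N C k a Cst s δA δ₁ (P.mesh 0 ^ P.d * Cst) (cK1 P C k Cst s) (n + 1 + n') *
            (min (HiggsLattice.Site.tdist x₁ x' : ℝ) (HiggsLattice.Site.tdist x₂ x' : ℝ) / (P.L : ℝ) ^ k))) := by
  have hL : 1 < P.L := hL1
  have hL1' : (1 : ℝ) < (P.L : ℝ) := by exact_mod_cast hL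
  set J := n + n' with hJ
  have hMJ : n + 1 + n' = J + 1 := by omega
  have hc : 0 ≤ P.mesh 0 ^ P.d * Cst := mul_nonneg (pow_nonneg (P.mesh_pos 0).le _) hCst
  obtain ⟨-, hcK1⟩ := cK1_ge (P := P) (C := C) (k := k) hCst hs
  obtain ⟨hr0, hrδ, hcv0, hcd0⟩ := seqC_pos (P := P) (N := N) (C := C) (k := k) (a := a) (Cst := Cst) (s := s) (δA := δA)
    (δ₀ := δ₁) (cv₀ := P.mesh 0 ^ P.d * Cst) (cd₀ := cK1 P C k Cst s) hL hδ₁ le_rfl hc hcK1 hCst hs hδA J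
  have hes : 0 ≤ |C.e| * s := mul_nonneg (abs_nonneg _) hs
  have hκ₂ : 0 ≤ (P.mesh 0)⁻¹ * (|C.e| * δA) := mul_nonneg (inv_nonneg.mpr (P.mesh_pos 0).le) (mul_nonneg (abs_nonneg _) hδA)
  have hκ₄ : 0 ≤ kap4 P C k a s := kap4_nonneg hs
  have hca : 0 ≤ |B1.aSeq a P.L k| * (P.mesh k)⁻¹ ^ 2 := by positivity
  have haK : 0 < 1 - α := by linarith
  have hav : (1 : ℝ) < 2 + (J : ℝ) := by have := (Nat.cast_nonneg J : (0:ℝ) ≤ J); linarith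
  have hε : 0 ≤ (P.mesh 0 ^ P.d)⁻¹ := inv_nonneg.mpr (pow_nonneg (P.mesh_pos 0).le _)
  -- the Hölder prefactor
  set q : ℝ := (P.mesh 0 * (HiggsLattice.Site.tdist x₁ x₂ : ℝ)) ^ α with hq
  have ht12 : 0 < P.mesh 0 * (HiggsLattice.Site.tdist x₁ x₂ : ℝ) := by
    have h1 : (1 : ℝ) ≤ (HiggsLattice.Site.tdist x₁ x₂ : ℝ) := by
      exact_mod_cast B3Ineq211RegularTorus.one_le_tdist_of_ne' (Ne.symm hne)
    have := P.mesh_pos 0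
    positivity
  have hq0 : 0 < q := Real.rpow_pos_of_pos ht12 α
  -- the two one-anchor majorants of the Hölder column, at the rate of the state J
  set δJ := rateAt P N C k a Cst s δA δ₁ (P.mesh 0 ^ P.d * Cst) (cK1 P C k Cst s) J with hδJ
  set M₁ : HiggsLattice.Site P 0 → ℝ := fun y => maj P k cH (1 - α) δJ x₁ y with hM₁
  set M₂ : HiggsLattice.Site P 0 → ℝ := fun y => maj P k cH (1 - α) δJ x₂ y with hM₂
  set K : HiggsLattice.Site P 0 → ℝ := fun y => hcol C B msq a k x₁ x₂ Γ μ y with hK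
  have hKle : ∀ y, K y ≤ q * (M₁ y + M₂ y) := by
    intro y
    have h := h211 μ x₁ x₂ y hne Γ hΓ
    rw [div_le_iff₀ hq0] at h
    have hsplit : (∑ j ∈ Finset.range k, cH * P.mesh j ^ (((1 : ℝ) - α) - (P.d : ℝ)) *
          (Real.exp (-(δ₁ * (P.mesh j)⁻¹ * (P.mesh 0 * (HiggsLattice.Site.tdist x₁ y : ℝ)))) +
            Real.exp (-(δ₁ * (P.mesh j)⁻¹ * (P.mesh 0 * (HiggsLattice.Site.tdist x₂ y : ℝ))))))
        = maj P k cH (1 - α) δ₁ x₁ y + maj P k cH (1 - α) δ₁ x₂ y := by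
      unfold maj
      rw [← Finset.sum_add_distrib]
      exact Finset.sum_congr rfl fun j _ => by ring
    rw [hsplit] at h
    have h1 : maj P k cH (1 - α) δ₁ x₁ y ≤ M₁ y := maj_rate_mono hcH hrδ x₁ y
    have h2 : maj P k cH (1 - α) δ₁ x₂ y ≤ M₂ y := maj_rate_mono hcH hrδ x₂ y
    calc K y = hcol C B msq a k x₁ x₂ Γ μ y := rfl
      _ ≤ (maj P k cH (1 - α) δ₁ x₁ y + maj P k cH (1 - α) δ₁ x₂ y) * q := h
      _ ≤ (M₁ y + M₂ y) * q := mul_le_mul_of_nonneg_right (add_le_add h1 h2) hq0.le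
      _ = q * (M₁ y + M₂ y) := mul_comm _ _
  -- the inner field and its state
  have hstate := fun i' : Ix N =>
    state_op116_cb hδ₁ hδ₁1 hCst h210B h210AB hmsq ha hk hkK i₀ hs hA hδA hregA x' n n' i'
  -- the per-i′ bound
  have hpt : ∀ i' : Ix N,
      ‖hol C B x₁ Γ (covDeriv C B (op116 C Finset.univ A B msq a k (n + 1) n' (cb P N 0 (x', i'))) ⟨x₂, μ⟩)
          - covDeriv C B (op116 C Finset.univ A B msq a k (n + 1) n' (cb P N 0 (x', i'))) ⟨x₁, μ⟩‖
        ≤ q * (maj P k (stepC P N k δJ (1 - α) (2 + (J : ℝ)) cH (cvAt P N C k a Cst s δA δ₁ (P.mesh 0 ^ P.d * Cst) (cK1 P C k Cst s) J) (cdAt P N C k a Cst s δA δ₁ (P.mesh 0 ^ P.d * Cst) (cK1 P C k Cst s) J)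
              (|C.e| * s) ((P.mesh 0)⁻¹ * (|C.e| * δA)) ((|C.e| * s) ^ 2) (kap4 P C k a s))
              ((1 - α) + (2 + (J : ℝ)) - 1) (δJ / 2 / P.L / 2) x₁ x'
          + maj P k (stepC P N k δJ (1 - α) (2 + (J : ℝ)) cH (cvAt P N C k a Cst s δA δ₁ (P.mesh 0 ^ P.d * Cst) (cK1 P C k Cst s) J) (cdAt P N C k a Cst s δA δ₁ (P.mesh 0 ^ P.d * Cst) (cK1 P C k Cst s) J)
              (|C.e| * s) ((P.mesh 0)⁻¹ * (|C.e| * δA)) ((|C.e| * s) ^ 2) (kap4 P C k a s))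
              ((1 - α) + (2 + (J : ℝ)) - 1) (δJ / 2 / P.L / 2) x₂ x') := by
    intro i'
    set w := op116 C Finset.univ A B msq a k n n' (cb P N 0 (x', i')) with hw
    obtain ⟨hV, hD⟩ := hstate i'
    have hD' : ∀ b, ‖covDeriv C B w b‖ ≤ maj P k (cdAt P N C k a Cst s δA δ₁ (P.mesh 0 ^ P.d * Cst) (cK1 P C k Cst s) J) (2 + (J : ℝ) - 1) δJ b.src x' := by
      intro b; rw [show (2 : ℝ) + (J : ℝ) - 1 = 1 + (J : ℝ) by ring]; exact hD b
    rw [op116_succ_left_apply, ← holT_apply]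
    -- the Hölder row
    have hrow := norm_holT_G_srcV_le (C := C) (B := B) (msq := msq) (a := a) (k := k) A hA hregA x₁ x₂ Γ μ w
    -- the averaging source through the Hölder functional
    set T : ScalarField P 0 N →ₗ[ℝ] E N :=
      holT C B x₁ x₂ Γ μ ∘ₗ (propagatorK C Finset.univ B msq a k : ScalarField P 0 N →ₗ[ℝ] ScalarField P 0 N) with hT
    have hT' : ∀ φ : ScalarField P 0 N, T φ = holT C B x₁ x₂ Γ μ (propagatorK C Finset.univ B msq a k φ) := fun φ => rfl
    have havg := norm_mapE_avgSrc_le_block (C := C) (A := A) (B := B) (k := k) T hkK hs hA w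
    have hcolT : ∀ z, ∑ i : Ix N, ‖T (cb P N 0 (z, i))‖ = K z := fun z => by simp only [hT', hK]; rfl
    simp only [hcolT] at havg
    rw [hT'] at havg
    -- the full row at the kernel K
    have hR : ‖holT C B x₁ x₂ Γ μ (propagatorK C Finset.univ B msq a k (srcV C A B k Finset.univ a w))‖
        ≤ (∑ b : HiggsLattice.PBond P 0,
            (|C.e| * s * ‖covDeriv C B w b‖ * K b.tgt
              + ((P.mesh 0)⁻¹ * (|C.e| * δA) * ‖w b.src‖ + |C.e| * s * ‖covDeriv C B w b‖) * K b.src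
              + (|C.e| * s) ^ 2 * ‖w b.tgt‖ * K b.tgt))
          + kap4 P C k a s * ∑ z : HiggsLattice.Site P 0, K z *
              (((P.L : ℝ) ^ (k * P.d))⁻¹ * ∑ u ∈ blockK k (blockIter k z), ‖w u‖) := by
      refine hrow.trans (add_le_add le_rfl ?_)
      refine (mul_le_mul_of_nonneg_left havg hca).trans (le_of_eq ?_)
      rw [kap4, Finset.mul_sum, Finset.mul_sum]
      exact Finset.sum_congr rfl fun z _ => by ring
    -- split the kernel into the two anchors
    have hsplit := row_le_of_kernel_le_add (k := k) hes hκ₂ (sq_nonneg (|C.e| * s)) hκ₄ K M₁ M₂ hKle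
      (fun y => ‖w y‖) (fun y => norm_nonneg _) (fun b => ‖covDeriv C B w b‖) (fun b => norm_nonneg _)
    -- each anchor: one step with a_K = 1 − α
    have hstep := fun (p : HiggsLattice.Site P 0) =>
      row_step_le (N := N) hL hk hkK hr0 (hrδ.trans hδ₁1) haK hav hcH hcv0 hcd0 hes hκ₂ (sq_nonneg (|C.e| * s)) hκ₄ i₀ p x'
        (fun y => maj P k cH (1 - α) δJ p y) (fun y => maj_nonneg hcH p y) (fun y => le_rfl)
        (fun y => ‖w y‖) (fun y => norm_nonneg _) hV (fun b => ‖covDeriv C B w b‖) (fun b => norm_nonneg _) hD'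
    exact hR.trans (hsplit.trans (mul_le_mul_of_nonneg_left (add_le_add (hstep x₁) (hstep x₂)) hq0.le))
  -- top-scale domination of the two majorants and assembly
  set cS := stepC P N k δJ (1 - α) (2 + (J : ℝ)) cH (cvAt P N C k a Cst s δA δ₁ (P.mesh 0 ^ P.d * Cst) (cK1 P C k Cst s) J) (cdAt P N C k a Cst s δA δ₁ (P.mesh 0 ^ P.d * Cst) (cK1 P C k Cst s) J)
    (|C.e| * s) ((P.mesh 0)⁻¹ * (|C.e| * δA)) ((|C.e| * s) ^ 2) (kap4 P C k a s) with hcS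
  have hcS0 : 0 ≤ cS := stepC_nonneg hL k hr0 haK hav hcH hcv0 hcd0 hes hκ₂ (sq_nonneg _) hκ₄
  have hsM : 0 < (1 - α) + (2 + (J : ℝ)) - 1 - (P.d : ℝ) := by
    rw [hMJ] at hd; push_cast at hd ⊢; linarith
  set δ' := δJ / 2 / P.L / 2 with hδ'
  have hδ'0 : 0 ≤ δ' := by rw [hδ']; positivity
  have hδ'eq : rateAt P N C k a Cst s δA δ₁ (P.mesh 0 ^ P.d * Cst) (cK1 P C k Cst s) (n + 1 + n') = δ' := by
    rw [hMJ]; rfl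
  have htop : ∀ p : HiggsLattice.Site P 0, maj P k cS ((1 - α) + (2 + (J : ℝ)) - 1) δ' p x'
      ≤ cS / ((P.L : ℝ) ^ ((1 - α) + (2 + (J : ℝ)) - 1 - (P.d : ℝ)) - 1) * P.mesh k ^ ((1 - α) + (2 + (J : ℝ)) - 1 - (P.d : ℝ)) *
          Real.exp (-(δ' * (P.mesh k)⁻¹ * (P.mesh 0 * (HiggsLattice.Site.tdist p x' : ℝ)))) := by
    intro p
    unfold maj
    exact majorant_le_top hL hcS0 hsM hδ'0 p x'
  have hexp : (1 - α) + (2 + (J : ℝ)) - 1 - (P.d : ℝ) = (1 : ℝ) + ((J + 1 : ℕ) : ℝ) - α - (P.d : ℝ) := by push_cast; ring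
  have hgeom : 0 < (P.L : ℝ) ^ ((1 : ℝ) + ((J + 1 : ℕ) : ℝ) - α - (P.d : ℝ)) - 1 := by
    have : (1 : ℝ) < (P.L : ℝ) ^ ((1 : ℝ) + ((J + 1 : ℕ) : ℝ) - α - (P.d : ℝ)) := Real.one_lt_rpow hL1' (by rw [← hexp]; exact hsM)
    linarith
  set Z : ℝ := cS / ((P.L : ℝ) ^ ((1 : ℝ) + ((J + 1 : ℕ) : ℝ) - α - (P.d : ℝ)) - 1) *
    (P.mesh k ^ (J + 1) * (P.mesh k * (P.mesh k ^ P.d)⁻¹ * (P.mesh k ^ α)⁻¹)) with hZ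
  have hZ0 : 0 ≤ Z := by
    have := P.mesh_pos k
    rw [hZ]; positivity
  have htop' : ∀ p : HiggsLattice.Site P 0, maj P k cS ((1 - α) + (2 + (J : ℝ)) - 1) δ' p x'
      ≤ Z * Real.exp (-(δ' * ((HiggsLattice.Site.tdist p x' : ℝ) / (P.L : ℝ) ^ k))) := by
    intro p
    refine (htop p).trans (le_of_eq ?_)
    rw [hexp, mesh_rpow_split_holder, B3Op116DKernelRegularTorus.rate_div_eq, hZ]
  have hLk : (0 : ℝ) < (P.L : ℝ) ^ k := by positivity
  have hsum2 := exp_add_exp_le_two_exp_min hδ'0 hLk (HiggsLattice.Site.tdist x₁ x' : ℝ) (HiggsLattice.Site.tdist x₂ x' : ℝ)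
  calc (P.mesh 0 ^ P.d)⁻¹ * ∑ i' : Ix N,
        ‖hol C B x₁ Γ (covDeriv C B (op116 C Finset.univ A B msq a k (n + 1) n' (cb P N 0 (x', i'))) ⟨x₂, μ⟩)
          - covDeriv C B (op116 C Finset.univ A B msq a k (n + 1) n' (cb P N 0 (x', i'))) ⟨x₁, μ⟩‖
      ≤ (P.mesh 0 ^ P.d)⁻¹ * ∑ _i' : Ix N, q * (Z * Real.exp (-(δ' * ((HiggsLattice.Site.tdist x₁ x' : ℝ) / (P.L : ℝ) ^ k)))
          + Z * Real.exp (-(δ' * ((HiggsLattice.Site.tdist x₂ x' : ℝ) / (P.L : ℝ) ^ k)))) := by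
        refine mul_le_mul_of_nonneg_left (Finset.sum_le_sum fun i' _ => (hpt i').trans ?_) hε
        exact mul_le_mul_of_nonneg_left (add_le_add (htop' x₁) (htop' x₂)) hq0.le
    _ = q * ((P.mesh 0 ^ P.d)⁻¹ * (Fintype.card (Ix N) : ℝ) * Z) *
          (Real.exp (-(δ' * ((HiggsLattice.Site.tdist x₁ x' : ℝ) / (P.L : ℝ) ^ k)))
            + Real.exp (-(δ' * ((HiggsLattice.Site.tdist x₂ x' : ℝ) / (P.L : ℝ) ^ k)))) := by
        rw [Finset.sum_const, Finset.card_univ, nsmul_eq_mul]; ring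
    _ ≤ q * ((P.mesh 0 ^ P.d)⁻¹ * (Fintype.card (Ix N) : ℝ) * Z) *
          (2 * Real.exp (-(δ' * (min (HiggsLattice.Site.tdist x₁ x' : ℝ) (HiggsLattice.Site.tdist x₂ x' : ℝ) / (P.L : ℝ) ^ k)))) :=
        mul_le_mul_of_nonneg_left hsum2 (by positivity)
    _ = _ := by
        rw [hδ'eq, hMJ, holC, hZ, hq]
        ring

end Holder

/-! ## §4 Consumer convenience (v1.1, append-only): the sign of the Hölder constant

For the (2.5) assembly (p40's binder `hCH`): `holC(J) ≥ 0` above the Hölder threshold `d < 1 + (J+1) − α` (`α < 1`, `cH ≥ 0`). -/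

section Consumers

variable {C : ChargeData N} {k : ℕ} {a Cst s δA δ₁ α cH : ℝ}

/-- `holC(J) ≥ 0` above the Hölder threshold. [cite: Balaban1983Higgs3, (1.16) p.414] -/
theorem holC_nonneg (hL : 1 < P.L) (hδ₁ : 0 < δ₁) (hCst : 0 ≤ Cst) (hs : 0 ≤ s) (hδA : 0 ≤ δA) (hα1 : α < 1)
    (hcH : 0 ≤ cH) (J : ℕ) (hd : (P.d : ℝ) < 1 + ((J + 1 : ℕ) : ℝ) - α) :
    0 ≤ holC P N C k a δ₁ Cst s δA α cH J := by
  have hc : 0 ≤ P.mesh 0 ^ P.d * Cst := mul_nonneg (pow_nonneg (P.mesh_pos 0).le _) hCst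
  obtain ⟨-, hcK1⟩ := cK1_ge (P := P) (C := C) (k := k) hCst hs
  obtain ⟨hr0, -, hcv, hcd⟩ := seqC_pos (P := P) (N := N) (C := C) (k := k) (a := a) (Cst := Cst) (s := s) (δA := δA)
    (δ₀ := δ₁) (cv₀ := P.mesh 0 ^ P.d * Cst) (cd₀ := cK1 P C k Cst s) hL hδ₁ le_rfl hc hcK1 hCst hs hδA J
  have hL1 : (1 : ℝ) < (P.L : ℝ) := by exact_mod_cast hL
  have hpow : 1 < (P.L : ℝ) ^ ((1 : ℝ) + ((J + 1 : ℕ) : ℝ) - α - (P.d : ℝ)) := Real.one_lt_rpow hL1 (by linarith)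
  have hε : 0 ≤ (P.mesh 0 ^ P.d)⁻¹ := inv_nonneg.mpr (pow_nonneg (P.mesh_pos 0).le _)
  have hes : 0 ≤ |C.e| * s := mul_nonneg (abs_nonneg _) hs
  have hκ₂ : 0 ≤ (P.mesh 0)⁻¹ * (|C.e| * δA) :=
    mul_nonneg (inv_nonneg.mpr (P.mesh_pos 0).le) (mul_nonneg (abs_nonneg _) hδA)
  have hJ : (1 : ℝ) < 2 + (J : ℝ) := by have := (Nat.cast_nonneg J : (0 : ℝ) ≤ J); linarith
  have hκ₄ : 0 ≤ kap4 P C k a s := kap4_nonneg hs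
  have hstep := stepC_nonneg (P := P) (N := N) hL k hr0 (by linarith : 0 < 1 - α) hJ hcH hcv hcd hes hκ₂ (pow_nonneg hes 2) hκ₄
  unfold holC
  exact mul_nonneg (by norm_num) (mul_nonneg (mul_nonneg hε (Nat.cast_nonneg _)) (div_nonneg hstep (by linarith)))

end Consumers

end Literature.MathematicalPhysics.QuantumFieldTheory.Balaban1983to89.B3Op116HolderKernelRegularTorus
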